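import Summits.BirchSwinnertonDyer.BirchSwinnertonDyer.Theorems.PrintCf2SplitBadTwoLineLocalDefectVbarMover
import Summits.BirchSwinnertonDyer.BirchSwinnertonDyer.Theorems.PrintCf2SplitBadTwoLineDecompVbarTrivial
import Summits.BirchSwinnertonDyer.BirchSwinnertonDyer.Theorems.PrintCf2SplitBadTwoTowerOverSplitLines
import HarnessLib

/-!
# Road α, crux `PrintCf2.SplitBadTwoRankOneOfFacts` (stmt-BirchSwinnertonDyer-20368), brick (RES)(b2-ii) ON THE FRAMES WITH `d ≡ 7 (mod 8)`:
# above `v̄`, Greenberg's UNRAMIFIED condition and Agboola's STRICT condition on `H¹(K*_∞, W*)` COINCIDE — `Def(v̄) = 0`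

Cell `bsd-print-cf2`, width seat `bsd-line-cf2-p1-w6` g4; `--supports stmt-BirchSwinnertonDyer-20368 --as helper`. HONEST FRAMING: nothing here
closes the crux or a registered stub; no summit statement is proved by this seat; BSD is not proved by any of this. No definition, no named
fact, no `sorry`.

Frame: member `C • W = cm7^{(d)}` (`d ≠ 0`), `K` imaginary quadratic, `2 = v v̄`, `π² = π − 2`, `r² = r − 2`, `W* = ↥((W.baseChange K).endEigenPrimaryTorsion 2 π r)`
pinned at `v` (`hpin`), `κ'` a `ℤ₂`-line unramified outside `v̄` (the line `K*_∞`). Inputs, all in the kernel: (C3) `mem_kerSubgroup_iff_smul_of_frame`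
(`ker κ'` acts on `W*` by signs), the kernel-type fixer at `v̄` (`smul_eq_of_kernelType` with `endEigenPrimaryTorsion_two_localTypes_named_of_pinned`),
B15 `natCard_localKer_vbar_eq_two_of_frame_of_kerC3` (`d ≡ 7 (8)`: `#LK_v̄ = 2`) vs `natCard_localKer_vbar_eq_one_of_frame` ((Hv̄-triv) ⇒ `#LK_v̄ = 1`),
-w5 g4 `SplitPrimeLine.inertia_not_le_kerSubgroup_of_isUnramifiedOutside` (the line is ramified at `v̄`), `endEigenPrimaryTorsion_two_structure`
(`W*` is `2`-divisible with cyclic `2^k`-torsion), and files 1–3 of the brick (p687174, p687207, `…LineLocalDefectVbarMover`).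

* `smul_eq_self_of_mem_inertia_vbar_of_kerSubgroup_of_frame` (`d ≡ 3 (mod 4)`): an element of `I_v̄ ∩ ker κ'` acts TRIVIALLY on `W*` (it acts as `±1` by
  (C3) and fixes `W*[4]` — sign `+1` on `√(−d)`, degree `0`).
* `exists_mover_vbar_of_frame` (`d ≡ 7 (mod 8)`): some `δ₀ ∈ D_v̄ ∩ ker κ'` acts as `−1` on `W*` (else (Hv̄-triv) and `#LK_v̄ = 1 ≠ 2`).
* `two_divisible_endEigenPrimaryTorsion`, `eq_of_two_nsmul_eq_zero_endEigenPrimaryTorsion` — the module-side hypotheses of file 1.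
* **`greenbergKer_strictDatum_vbar_eq_awayKer_of_frame`** (`d ≡ 7 (mod 8)`): `(strictDatum W* v̄).greenbergKer (ker κ') = awayKer (ker κ') W* v̄` — over
  the line `K*_∞` the UNRAMIFIED condition at `v̄` for `W*⁺_v̄ = 0` equals the STRICT one: the (RES)(b2) local defect above `v̄` VANISHES on these frames.

presearch: Rubin LNM 1716 §3 Lemma 3.6 (ii), Cor. 3.17 (local structure of `E[𝔭^∞]` over the local tower); Greenberg LNM 1716 §3; Agboola 2007 §3
Prop. 3.2 — held; no new fact. beyond-print theorem: no.

References: [Rubin1999] §3 Lemma 3.6 (ii), Cor. 3.17; [GreenbergLNM1716] §3; [Agboola2007] §3 Prop. 3.2; [NeukirchANT1999] II §9 (9.9).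
-/

noncomputable section

open scoped Classical

set_option linter.dupNamespace false
set_option autoImplicit false

open NumberField IsDedekindDomain Field WeierstrassCurve
open Literature.NumberTheory.EllipticCurves Literature.NumberTheory.EllipticCurves.GreenbergSelmer
open Literature.NumberTheory.GaloisRepresentations
open Summit.BirchSwinnertonDyer.BirchSwinnertonDyer.Theorems.PrintCf2.AdditiveAtSeven
open Summit.BirchSwinnertonDyer.BirchSwinnertonDyer.Theorems.PrintCf2.CMPrimes
open Summit.BirchSwinnertonDyer.BirchSwinnertonDyer.Theorems.PrintCf2.RestrictedSelmerPair
open Summit.BirchSwinnertonDyer.BirchSwinnertonDyer.Theorems.PrintCf2.SplitPrimeLine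

namespace Summit.BirchSwinnertonDyer.BirchSwinnertonDyer.Theorems.PrintCf2.LineLocallyTrivial

variable {K : Type} [Field K] [NumberField K]

/-! ## §1. `I_v̄ ∩ ker κ'` acts trivially on `W*` (`d ≡ 3 (mod 4)`) -/

/-- **On a frame with `d ≡ 3 (mod 4)`, every element of `I_v̄ ∩ ker κ'` acts TRIVIALLY on `W*`.** By (C3) it acts as `+1` or `−1`; an inertia
element has degree `0` and fixes `√(−d)` (`(−d) ≡ 1 (mod 4)`: `smul_geomSqrt_eq_of_mem_absInertia_of_emod_four_eq_one`), so its signs on `ι√d` and `ζ₄`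
agree and the kernel-type fixer `smul_eq_of_kernelType` makes it FIX `W*[4]`; since `W*[4]` has a point of order `4`, the sign is `+1`.
[cite: Rubin1999, §3 Lemma 3.6 (ii) and Cor. 3.17] -/
theorem smul_eq_self_of_mem_inertia_vbar_of_kerSubgroup_of_frame {d : ℤ} (hd0 : d ≠ 0) (hd4 : d % 4 = 3)
    (W : WeierstrassCurve ℚ) [W.IsElliptic] (C : VariableChange ℚ) (hC : C • W = cm7.quadraticTwist (d : ℚ)) (hK : IsImaginaryQuadratic K)
    (v vbar : HeightOneSpectrum (𝓞 K)) (hv : ((2 : ℕ) : 𝓞 K) ∈ v.asIdeal) (hvbar : ((2 : ℕ) : 𝓞 K) ∈ vbar.asIdeal) (hne : vbar ≠ v)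
    (π : (W.baseChange K).endRing) (hrel : (π : AddMonoid.End (W.baseChange K).geomPoints) * π = π - 2) {r : ℤ_[2]} (hr : r * r = r - 2)
    (hpin : ∀ τ ∈ GreenbergSelmer.inertia v, ∀ x : ↥((W.baseChange K).endEigenPrimaryTorsion 2 π r), τ • x = x ∨ τ • x = -x)
    (κ' : ZpExtension K 2) (hκ' : κ'.IsUnramifiedOutside vbar)
    {τ : absoluteGaloisGroup K} (hτI : τ ∈ GreenbergSelmer.inertia vbar) (hτκ : τ ∈ κ'.kerSubgroup)
    (x : ↥((W.baseChange K).endEigenPrimaryTorsion 2 π r)) : τ • x = x := by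
  haveI : Fact (Nat.Prime 2) := ⟨Nat.prime_two⟩
  have hj : W.j = -3375 := j_eq_of_smul_eq_cm7Twist hd0 W C hC
  obtain ⟨θ, hθ⟩ := exists_sq_eq_neg_seven_of_cmEndo_mem_endRing W K hj π hrel
  have hK2 : Module.finrank ℚ K = 2 := hK.1
  rcases (mem_kerSubgroup_iff_smul_of_frame hd0 W C hC hK v vbar hv hvbar hne π hrel hr hpin κ' hκ' τ).mp hτκ with h | h
  · exact h x
  · exfalso
    -- a point of order `4` in `W*`, fixed by `τ`
    obtain ⟨-, -, -, -, -, -, hgen, -⟩ := endEigenPrimaryTorsion_two_structure W hj K hθ π hrel hr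
    obtain ⟨g, hg, hord, -⟩ := hgen 2
    have hg4 : 4 • g = 0 := by rw [show (4 : ℕ) = 2 ^ 2 from rfl, ← hord]; exact addOrderOf_nsmul_eq_zero g
    have hg2 : 2 • g ≠ 0 := fun h2 ↦ by
      have hdvd : addOrderOf g ∣ 2 := addOrderOf_dvd_of_nsmul_eq_zero h2
      rw [hord] at hdvd
      exact absurd (Nat.le_of_dvd two_pos hdvd) (by norm_num)
    -- the kernel-type clause (R) at `v̄` for `E[𝔮_r^∞]` and the named local type
    obtain ⟨hcl', -⟩ := endEigenPrimaryTorsion_two_pinningClause_swap W K hj hK hθ π hrel hr hv hvbar hne hpin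
    have hcl'' : ∀ τ ∈ GreenbergSelmer.inertia vbar, ∀ y ∈ (W.baseChange K).endEigenPrimaryTorsion 2 π (1 - r),
        τ • y = y ∨ τ • y = -y := fun τ hτ y hy ↦ by
      rcases hcl' τ hτ ⟨y, hy⟩ with h | h
      · exact Or.inl (congrArg Subtype.val h)
      · exact Or.inr (congrArg Subtype.val h)
    have h1r : (1 - r) * (1 - r) = (1 - r) - 2 := by linear_combination hr
    have hdQ : (d : ℚ) ≠ 0 := by exact_mod_cast hd0
    obtain ⟨α, hα, -, hUR⟩ := endEigenPrimaryTorsion_two_localTypes_named_of_pinned W K hj hθ π hrel h1r hdQ C hC vbar hvbar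
      (inertiaDeg_eq_one_of_ne_two K hK2 hvbar hv hne.symm) hcl''
    simp only [sub_sub_cancel] at hUR
    have HR := fun σ n hσ s hs ↦ (hUR σ n hσ s hs).2
    have hm4 : (-d) % 4 = 1 := by omega
    -- `τ = res σ` with `σ ∈ I_{K_v̄}`
    obtain ⟨σ, hσI, hστ⟩ := Subgroup.mem_map.mp hτI
    have hσ0 : IsFrobPow σ ((0 : ℕ) : ℤ) := by exact_mod_cast isFrobPow_zero_iff_mem_absInertia.mpr hσI
    have hB := smul_geomSqrt_eq_of_mem_absInertia_of_emod_four_eq_one vbar hvbar hm4 hσI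
    -- the fixer with `n = 0`: signs `s = e`
    have hfix : absGaloisRestrict K (vbar.adicCompletion K) σ • g = g := by
      set γ := absGaloisRestrict K (vbar.adicCompletion K) σ with hγ
      rcases smul_absClosureEmbedding_geomSqrt_eq_or K (d : ℚ) γ with hA | hA <;>
        rcases smul_absClosureEmbedding_geomSqrt_eq_or K (-1 : ℚ) γ with hZ | hZ
      · exact smul_eq_of_kernelType K W hα HR hσ0 (s := 1) (e := 1) (Or.inl ⟨hA, rfl⟩) (Or.inl ⟨hZ, rfl⟩) (by norm_num) hg hg4
      · have hse := sign_mul_eq_of_smul_geomSqrt K hd0 γ (s := 1) (e := -1) (Or.inl ⟨hA, rfl⟩) (Or.inr ⟨hZ, rfl⟩) (Or.inl ⟨hB, rfl⟩)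
        norm_num at hse
      · have hse := sign_mul_eq_of_smul_geomSqrt K hd0 γ (s := -1) (e := 1) (Or.inr ⟨hA, rfl⟩) (Or.inl ⟨hZ, rfl⟩) (Or.inl ⟨hB, rfl⟩)
        norm_num at hse
      · exact smul_eq_of_kernelType K W hα HR hσ0 (s := -1) (e := -1) (Or.inr ⟨hA, rfl⟩) (Or.inr ⟨hZ, rfl⟩) (by norm_num) hg hg4
    have hτg : τ • (⟨g, hg⟩ : ↥((W.baseChange K).endEigenPrimaryTorsion 2 π r)) = ⟨g, hg⟩ := by
      apply Subtype.ext
      change τ • g = g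
      have : τ = (absGaloisRestrict K (vbar.adicCompletion K)).toMonoidHom σ := hστ.symm
      rw [this]
      exact hfix
    have hneg := h ⟨g, hg⟩
    rw [hτg] at hneg
    have h' := congrArg Subtype.val hneg
    change g = -g at h'
    exact hg2 (by rw [two_nsmul]; exact add_eq_zero_iff_eq_neg.mpr h')

/-! ## §2. A mover outside inertia exists (`d ≡ 7 (mod 8)`) -/

/-- **On a frame with `d ≡ 7 (mod 8)`, some `δ₀ ∈ D_v̄ ∩ ker κ'` acts as `−1` on `W*`.** Otherwise, by (C3), `ker κ' ⊓ D_v̄` acts trivially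
((Hv̄-triv)) and B15 gives `#LK_v̄ = 1` (`natCard_localKer_vbar_eq_one_of_frame`), contradicting `#LK_v̄ = 2`
(`natCard_localKer_vbar_eq_two_of_frame_of_kerC3`, (C3-loc) supplied by (C3)). [cite: Rubin1999, §3 Lemma 3.6 (ii) and Cor. 3.17]
[cite: Agboola2007, §3 Prop. 3.2] -/
theorem exists_mover_vbar_of_frame {d : ℤ} (hd0 : d ≠ 0) (hd8 : d % 8 = 7)
    (W : WeierstrassCurve ℚ) [W.IsElliptic] (C : VariableChange ℚ) (hC : C • W = cm7.quadraticTwist (d : ℚ)) (hK : IsImaginaryQuadratic K)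
    (v vbar : HeightOneSpectrum (𝓞 K)) (hv : ((2 : ℕ) : 𝓞 K) ∈ v.asIdeal) (hvbar : ((2 : ℕ) : 𝓞 K) ∈ vbar.asIdeal) (hne : vbar ≠ v)
    (π : (W.baseChange K).endRing) (hrel : (π : AddMonoid.End (W.baseChange K).geomPoints) * π = π - 2) {r : ℤ_[2]} (hr : r * r = r - 2)
    (hpin : ∀ τ ∈ GreenbergSelmer.inertia v, ∀ x : ↥((W.baseChange K).endEigenPrimaryTorsion 2 π r), τ • x = x ∨ τ • x = -x)
    (κ' : ZpExtension K 2) (hκ' : κ'.IsUnramifiedOutside vbar) :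
    ∃ δ₀ ∈ GreenbergSelmer.decomp vbar, δ₀ ∈ κ'.kerSubgroup ∧ ∀ x : ↥((W.baseChange K).endEigenPrimaryTorsion 2 π r), δ₀ • x = -x := by
  haveI : Fact (Nat.Prime 2) := ⟨Nat.prime_two⟩
  have hC3 : ∀ σ ∈ decomp vbar, σ ∈ κ'.kerSubgroup ↔
      ((∀ x : ↥((W.baseChange K).endEigenPrimaryTorsion 2 π r), σ • x = x) ∨
        (∀ x : ↥((W.baseChange K).endEigenPrimaryTorsion 2 π r), σ • x = -x)) := fun σ _ ↦
    mem_kerSubgroup_iff_smul_of_frame hd0 W C hC hK v vbar hv hvbar hne π hrel hr hpin κ' hκ' σ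
  by_contra hno
  push Not at hno
  have htriv : ∀ σ ∈ κ'.kerSubgroup ⊓ decomp vbar, ∀ x : ↥((W.baseChange K).endEigenPrimaryTorsion 2 π r), σ • x = x := by
    intro σ hσ x
    obtain ⟨hσκ, hσD⟩ := Subgroup.mem_inf.mp hσ
    rcases (hC3 σ hσD).mp hσκ with h | h
    · exact h x
    · obtain ⟨x₀, hx₀⟩ := hno σ hσD hσκ
      exact absurd (h x₀) hx₀
  have h1 := natCard_localKer_vbar_eq_one_of_frame hd0 W C hC hK v vbar hv hvbar hne π hrel hr κ' htriv
  have h2 := natCard_localKer_vbar_eq_two_of_frame_of_kerC3 hd0 hd8 W C hC hK v vbar hv hvbar hne π hrel hr hpin κ' hC3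
  rw [h1] at h2
  exact absurd h2 (by norm_num)

/-! ## §3. Module-side inputs: `W*` is `2`-divisible with one element of order `2` -/

/-- `W*` is `2`-divisible (in the subtype). [cite: Rubin1999, §2 and Prop. 5.4] -/
theorem two_divisible_endEigenPrimaryTorsion (W : WeierstrassCurve ℚ) [W.IsElliptic] (hj : W.j = -3375) {θ : K} (hθ : θ ^ 2 = -7)
    (π : (W.baseChange K).endRing) (hrel : (π : AddMonoid.End (W.baseChange K).geomPoints) * π = π - 2) {r : ℤ_[2]} (hr : r * r = r - 2)
    (m : ↥((W.baseChange K).endEigenPrimaryTorsion 2 π r)) : ∃ m' : ↥((W.baseChange K).endEigenPrimaryTorsion 2 π r), (2 : ℕ) • m' = m := by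
  haveI : Fact (Nat.Prime 2) := ⟨Nat.prime_two⟩
  obtain ⟨-, -, -, -, hdiv, -⟩ := endEigenPrimaryTorsion_two_structure W hj K hθ π hrel hr
  obtain ⟨y, hy, hy2⟩ := hdiv m m.2
  exact ⟨⟨y, hy⟩, Subtype.ext (by rw [AddSubmonoidClass.coe_nsmul]; exact hy2)⟩

/-- `W*` has exactly one element of order `2`: two non-zero `2`-torsion elements coincide (`#(W* ⊓ E[2]) = 2`). [cite: Rubin1999, §2 and Prop. 5.4] -/
theorem eq_of_two_nsmul_eq_zero_endEigenPrimaryTorsion (W : WeierstrassCurve ℚ) [W.IsElliptic] (hj : W.j = -3375) {θ : K} (hθ : θ ^ 2 = -7)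
    (π : (W.baseChange K).endRing) (hrel : (π : AddMonoid.End (W.baseChange K).geomPoints) * π = π - 2) {r : ℤ_[2]} (hr : r * r = r - 2)
    (x y : ↥((W.baseChange K).endEigenPrimaryTorsion 2 π r)) (hx : (2 : ℕ) • x = 0) (hy : (2 : ℕ) • y = 0) (hx0 : x ≠ 0) (hy0 : y ≠ 0) :
    x = y := by
  haveI : Fact (Nat.Prime 2) := ⟨Nat.prime_two⟩
  obtain ⟨-, -, -, -, -, hcard, -⟩ := endEigenPrimaryTorsion_two_structure W hj K hθ π hrel hr
  set T := (W.baseChange K).endEigenPrimaryTorsion 2 π r ⊓ AddSubgroup.torsionBy ((W.baseChange K).geomPrimaryTorsion 2) (2 : ℕ) with hT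
  have h2 : Nat.card ↥T = 2 := by
    have h := hcard 1
    norm_num at h
    exact h
  have hmemT : ∀ z : ↥((W.baseChange K).endEigenPrimaryTorsion 2 π r), (2 : ℕ) • z = 0 → (z : (W.baseChange K).geomPrimaryTorsion 2) ∈ T := by
    intro z hz
    refine AddSubgroup.mem_inf.mpr ⟨z.2, ?_⟩
    change (z : (W.baseChange K).geomPrimaryTorsion 2) ∈ Submodule.torsionBy ℤ ((W.baseChange K).geomPrimaryTorsion 2) 2
    rw [Submodule.mem_torsionBy_iff, two_zsmul, ← two_nsmul]
    have := congrArg Subtype.val hz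
    rwa [AddSubmonoidClass.coe_nsmul, ZeroMemClass.coe_zero] at this
  -- the elements `0, x, y` of a type of cardinality `2`
  obtain ⟨a, b, hab, huniv⟩ := Nat.card_eq_two_iff.mp h2
  have hmem : ∀ z : ↥T, z = a ∨ z = b := fun z ↦ by
    have hz : z ∈ ({a, b} : Set ↥T) := huniv ▸ Set.mem_univ z
    simpa using hz
  set x' : ↥T := ⟨(x : (W.baseChange K).geomPrimaryTorsion 2), hmemT x hx⟩ with hx'def
  set y' : ↥T := ⟨(y : (W.baseChange K).geomPrimaryTorsion 2), hmemT y hy⟩ with hy'def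
  have hx' : x' ≠ 0 := fun h ↦ by
    have hv : (x : (W.baseChange K).geomPrimaryTorsion 2) = 0 := by rw [hx'def] at h; exact congrArg Subtype.val h
    exact hx0 (Subtype.ext hv)
  have hy' : y' ≠ 0 := fun h ↦ by
    have hv : (y : (W.baseChange K).geomPrimaryTorsion 2) = 0 := by rw [hy'def] at h; exact congrArg Subtype.val h
    exact hy0 (Subtype.ext hv)
  have hxy : x' = y' := by
    rcases hmem 0 with h0 | h0
    · have hxb : x' = b := (hmem x').resolve_left fun h ↦ hx' (h.trans h0.symm)
      have hyb : y' = b := (hmem y').resolve_left fun h ↦ hy' (h.trans h0.symm)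
      rw [hxb, hyb]
    · have hxa : x' = a := (hmem x').resolve_right fun h ↦ hx' (h.trans h0.symm)
      have hya : y' = a := (hmem y').resolve_right fun h ↦ hy' (h.trans h0.symm)
      rw [hxa, hya]
  rw [hx'def, hy'def] at hxy
  have hv := congrArg (fun z : ↥T ↦ (z : (W.baseChange K).geomPrimaryTorsion 2)) hxy
  exact Subtype.ext hv

/-! ## §4. `Def(v̄) = 0` on the frames with `d ≡ 7 (mod 8)` -/

/-- **UNRAMIFIED = STRICT ABOVE `v̄` OVER THE LINE `K*_∞` on the frames with `d ≡ 7 (mod 8)`**: for `W* = ↥((W.baseChange K).endEigenPrimaryTorsion 2 π r)`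
(pinned at `v`) and the `ℤ₂`-line `κ'` unramified outside `v̄`, `(strictDatum W* v̄).greenbergKer (ker κ') = awayKer (ker κ') W* v̄` — file 3's
`greenbergKer_strictDatum_eq_awayKer_of_mover` with: ramification at `v̄` (-w5 g4), signs (C3), `I_v̄ ∩ ker κ'` trivial (§1), the mover (§2), divisibility
and the unique element of order `2` (§3), open stabilisers. So the (RES)(b2) local defect above `v̄` VANISHES on these frames.
[cite: GreenbergLNM1716, §3] [cite: Rubin1999, §3 Lemma 3.6 (ii) and Cor. 3.17] [cite: Agboola2007, §3 Prop. 3.2] -/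
theorem greenbergKer_strictDatum_vbar_eq_awayKer_of_frame {d : ℤ} (hd0 : d ≠ 0) (hd8 : d % 8 = 7)
    (W : WeierstrassCurve ℚ) [W.IsElliptic] (C : VariableChange ℚ) (hC : C • W = cm7.quadraticTwist (d : ℚ)) (hK : IsImaginaryQuadratic K)
    (v vbar : HeightOneSpectrum (𝓞 K)) (hv : ((2 : ℕ) : 𝓞 K) ∈ v.asIdeal) (hvbar : ((2 : ℕ) : 𝓞 K) ∈ vbar.asIdeal) (hne : vbar ≠ v)
    (π : (W.baseChange K).endRing) (hrel : (π : AddMonoid.End (W.baseChange K).geomPoints) * π = π - 2) {r : ℤ_[2]} (hr : r * r = r - 2)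
    (hpin : ∀ τ ∈ GreenbergSelmer.inertia v, ∀ x : ↥((W.baseChange K).endEigenPrimaryTorsion 2 π r), τ • x = x ∨ τ • x = -x)
    (κ' : ZpExtension K 2) (hκ' : κ'.IsUnramifiedOutside vbar) :
    (Castella2018.AcSelmer.strictDatum ↥((W.baseChange K).endEigenPrimaryTorsion 2 π r) vbar).greenbergKer κ'.kerSubgroup =
      GreenbergSelmer.awayKer κ'.kerSubgroup ↥((W.baseChange K).endEigenPrimaryTorsion 2 π r) vbar := by
  haveI : Fact (Nat.Prime 2) := ⟨Nat.prime_two⟩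
  have hj : W.j = -3375 := j_eq_of_smul_eq_cm7Twist hd0 W C hC
  obtain ⟨θ, hθ⟩ := exists_sq_eq_neg_seven_of_cmEndo_mem_endRing W K hj π hrel
  have hd4 : d % 4 = 3 := by omega
  -- ramification of the line at `v̄`
  have hram : ¬ GreenbergSelmer.inertia vbar ≤ κ'.kerSubgroup := by
    have h := inertia_not_le_kerSubgroup_of_isUnramifiedOutside (p := 2) hK hκ' (adicCompletionPrime_mem_primesAbove K vbar)
    rwa [inertia_adicCompletionPrime_eq_map_absInertia K vbar] at h
  obtain ⟨δ₀, hδD, hδκ, hδ₀⟩ := exists_mover_vbar_of_frame hd0 hd8 W C hC hK v vbar hv hvbar hne π hrel hr hpin κ' hκ'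
  exact greenbergKer_strictDatum_eq_awayKer_of_mover κ' hram (isOpen_stabilizer_endEigenPrimaryTorsion _ 2 π r)
    (fun τ hτ hτκ x ↦ smul_eq_self_of_mem_inertia_vbar_of_kerSubgroup_of_frame hd0 hd4 W C hC hK v vbar hv hvbar hne π hrel hr hpin κ' hκ' hτ hτκ x)
    (fun g hg ↦ (mem_kerSubgroup_iff_smul_of_frame hd0 W C hC hK v vbar hv hvbar hne π hrel hr hpin κ' hκ' g).mp hg)
    hδD hδκ hδ₀ (two_divisible_endEigenPrimaryTorsion W hj hθ π hrel hr) (eq_of_two_nsmul_eq_zero_endEigenPrimaryTorsion W hj hθ π hrel hr)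

end Summit.BirchSwinnertonDyer.BirchSwinnertonDyer.Theorems.PrintCf2.LineLocallyTrivial

end
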